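import Literature.Probability.Percolation.ConditionalPositiveAssociationProofs
import HarnessLib

/-!
# The bystander's cluster: conditioning tools for a BHK inequality with a bystander

Towards `PercNearOneGluing.AdditiveGluing` (the case `|A∖b| = 2`); first of the
helper files proving the **bystander BHK inequality**
(`PercNearOneGluingAdditiveGluingBystanderBHK.lean`): for percolation restricted to `U` (product weight
`BHK2006.weight w` on `Set (Sym2 V)`), a source `s`, a *bystander* `o`, an arbitrary collection `𝓡` of vertex
sets none of which contains `s`, `F ≥ 0` increasing in `C_s`, and all `X, Y ⊆ U`,
`E[F(C_s) 1_{E_X} 1_{R_X}] · P(R_Y) ≤ E[F(C_s) 1_{R_{X∩Y}}] · E[1_{E_{X∪Y}} 1_{R_{X∪Y}}]`,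
where `R_T = {s ↮ T}` (`BHK2006.rD`) and `E_T = {o ↔ T} ∪ {K ∈ 𝓡}` is the (non-monotone!) **bystander
event**, `K = openCluster (ω ∩ edgesIn U) o` the open vertex cluster of `o` in `G[U]`.

This file (no new definitions; the objects are spelled out): the two conditioning devices —
* conditioning on `K = W` (`reach_restrict_rK`, `rC_restrict_rK`, `mem_rD_iff_rK`, `mem_rE_iff_rK`; the event
  `{K = W}` is determined by the pairs meeting `W`, `rK_inter_meeting_eq_iff`; block Fubini gives the
  **Markov property** `E[1_{K=W} Ψ] = P(K = W) E[Ψ]` for `Ψ` not looking at pairs meeting `W`,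
  `sum_ind_rK_mul`; fibering `sum_fiber_rK`);
* BHK's conditioning on the attachment set `S` of `Z = X ∩ Y` for the bystander event:
  `E_W ↦ E'_{(W∖Z)∪S}` with the SAME collection `𝓡` (`mem_rE_iff_restrict`), and the summed identity
  `step_sum'` (BHK's (6), cf. `BHK2006.step_sum`) for `H(C_s) 1_{E_W} 1_{R_W}`.
Everything is stated in the finite product-weight formalism of
`Literature.Probability.Percolation.ConditionalPositiveAssociationProofs` (`BHK2006.*`), reused verbatim.
-/

noncomputable section

namespace Summit.CriticalPhenomena.PercolationContinuityZ3.Theorems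

open Literature.Probability.Percolation Literature.Probability.Percolation.BHK2006
open DecisionTree (ind ind_of_mem ind_of_not_mem ind_nonneg)
open scoped Classical

namespace BystanderBHK

variable {V : Type*}

/-! ### The bystander's cluster and the bystander event -/

/-- The bystander's cluster grows with the configuration. [folklore] -/
theorem rK_mono (U : Finset V) (o : V) {ω ω' : Set (Sym2 V)} (h : ω ⊆ ω') :
    (openCluster (ω ∩ edgesIn U) o) ⊆ (openCluster (ω' ∩ edgesIn U) o) := fun _ hv =>
  hv.mono (openGraph_le (Set.inter_subset_inter_left _ h))

/-- The bystander's cluster grows with the vertex set. [folklore] -/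
theorem rK_mono_set {U U' : Finset V} (hU : U' ⊆ U) (o : V) (ω : Set (Sym2 V)) :
    (openCluster (ω ∩ edgesIn U') o) ⊆ (openCluster (ω ∩ edgesIn U) o) := fun _ hv =>
  hv.mono (openGraph_le (Set.inter_subset_inter_right _ (edgesIn_mono hU)))

/-- If `o ∈ T` the bystander event is sure. [folklore] -/
theorem mem_rE_of_mem {U : Finset V} {o : V} (𝓡 : Set (Set V)) {T : Set V} (ho : o ∈ T)
    (ω : Set (Sym2 V)) : ω ∈ {η | (∃ t ∈ T, t ∈ openCluster (η ∩ edgesIn U) o) ∨ openCluster (η ∩ edgesIn U) o ∈ 𝓡} :=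
  Or.inl ⟨o, ho, mem_openCluster_self (ω ∩ edgesIn U) o⟩

/-- The bystander event is monotone in `T`. [folklore] -/
theorem rE_mono {U : Finset V} {o : V} (𝓡 : Set (Set V)) {T T' : Set V} (h : T ⊆ T') :
    {η | (∃ t ∈ T, t ∈ openCluster (η ∩ edgesIn U) o) ∨ openCluster (η ∩ edgesIn U) o ∈ 𝓡} ⊆ {η | (∃ t ∈ T', t ∈ openCluster (η ∩ edgesIn U) o) ∨ openCluster (η ∩ edgesIn U) o ∈ 𝓡} := by
  rintro ω (⟨t, ht, htK⟩ | hR)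
  · exact Or.inl ⟨t, h ht, htK⟩
  · exact Or.inr hR

/-! ### Conditioning on the bystander's cluster: `K = W` -/

/-- If `K = W ∌ s`, every vertex joined to `s` in `G[U]` is outside `W` and joined to `s` in
`G[U ∖ W]` (the boundary of `W` is closed). [folklore] -/
theorem reach_restrict_rK {U W : Finset V} {o s : V} {ω : Set (Sym2 V)}
    (hK : (openCluster (ω ∩ edgesIn U) o) = ↑W) (hs : s ∉ W) {v : V}
    (hv : (openGraph (ω ∩ edgesIn U)).Reachable s v) :
    v ∉ W ∧ (openGraph (ω ∩ edgesIn (U \ W))).Reachable s v := by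
  rw [SimpleGraph.reachable_iff_reflTransGen] at hv
  induction hv with
  | refl => exact ⟨hs, SimpleGraph.Reachable.refl s⟩
  | @tail b c _ hbc ih =>
    obtain ⟨hbW, hb⟩ := ih
    obtain ⟨hω, ⟨hbU, hcU⟩, hne⟩ := adj_iff.1 hbc
    have hcW : c ∉ W := fun hcW => by
      have hc : c ∈ (openCluster (ω ∩ edgesIn U) o) := by rw [hK]; exact hcW
      have hb' : b ∈ (openCluster (ω ∩ edgesIn U) o) := hc.trans (SimpleGraph.Adj.reachable hbc.symm)
      rw [hK] at hb'
      exact hbW hb'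
    refine ⟨hcW, hb.trans (SimpleGraph.Adj.reachable ?_)⟩
    exact adj_iff.2 ⟨hω, ⟨Finset.mem_sdiff.2 ⟨hbU, hbW⟩, Finset.mem_sdiff.2 ⟨hcU, hcW⟩⟩, hne⟩

/-- On `{K = W}`, `W ∌ s`: the cluster of `s` in `G[U]` is its cluster in `G[U ∖ W]`. [folklore] -/
theorem rC_restrict_rK {U W : Finset V} {o s : V} {ω : Set (Sym2 V)}
    (hK : (openCluster (ω ∩ edgesIn U) o) = ↑W) (hs : s ∉ W) : rC U s ω = rC (U \ W) s ω := by
  ext e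
  simp only [rC, mem_openEdgeCluster_iff, Set.mem_inter_iff]
  constructor
  · rintro ⟨⟨heω, heU⟩, hd, hr⟩
    exact ⟨⟨heω, fun v hv => Finset.mem_sdiff.2
      ⟨heU v hv, (reach_restrict_rK hK hs (hr v hv)).1⟩⟩, hd,
      fun v hv => (reach_restrict_rK hK hs (hr v hv)).2⟩
  · rintro ⟨⟨heω, heU⟩, hd, hr⟩
    exact ⟨⟨heω, fun v hv => (Finset.mem_sdiff.1 (heU v hv)).1⟩, hd, fun v hv =>
      (hr v hv).mono (openGraph_le
        (Set.inter_subset_inter_right _ (edgesIn_mono Finset.sdiff_subset)))⟩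

/-- On `{K = W}`, `W ∌ s`: `{s ↮ T in G[U]} = {s ↮ T ∖ W in G[U ∖ W]}`. [folklore] -/
theorem mem_rD_iff_rK {U W : Finset V} {o s : V} {ω : Set (Sym2 V)}
    (hK : (openCluster (ω ∩ edgesIn U) o) = ↑W) (hs : s ∉ W) (T : Set V) :
    ω ∈ rD U s T ↔ ω ∈ rD (U \ W) s (T \ ↑W) := by
  constructor
  · intro h x hx hreach
    exact h x hx.1 (hreach.mono (openGraph_le
      (Set.inter_subset_inter_right _ (edgesIn_mono Finset.sdiff_subset))))
  · intro h x hxT hreach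
    obtain ⟨hxW, hreach'⟩ := reach_restrict_rK hK hs hreach
    exact h x ⟨hxT, hxW⟩ hreach'

/-- On `{K = W}` the bystander event `E_T` is the constant `[W ∩ T ≠ ∅ ∨ W ∈ 𝓡]`. [folklore] -/
theorem mem_rE_iff_rK {U W : Finset V} {o : V} {ω : Set (Sym2 V)} (hK : (openCluster (ω ∩ edgesIn U) o) = ↑W)
    (𝓡 : Set (Set V)) (T : Set V) :
    ω ∈ {η | (∃ t ∈ T, t ∈ openCluster (η ∩ edgesIn U) o) ∨ openCluster (η ∩ edgesIn U) o ∈ 𝓡} ↔ (∃ t ∈ T, t ∈ (↑W : Set V)) ∨ (↑W : Set V) ∈ 𝓡 := by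
  simp only [Set.mem_setOf_eq, hK]

/-- Walks from `o` inside a set `W` containing every vertex reachable through edges meeting `W`
only use edges meeting `W`. [folklore] -/
theorem reach_inter_meeting {U W : Finset V} {o : V} {ω : Set (Sym2 V)}
    (hW : ∀ u, (openGraph ((ω ∩ meeting W) ∩ edgesIn U)).Reachable o u → u ∈ W) {v : V}
    (hv : (openGraph (ω ∩ edgesIn U)).Reachable o v) :
    (openGraph ((ω ∩ meeting W) ∩ edgesIn U)).Reachable o v := by
  rw [SimpleGraph.reachable_iff_reflTransGen] at hv
  induction hv with
  | refl => exact SimpleGraph.Reachable.refl o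
  | tail _ hbc ih =>
    obtain ⟨hω, hU, hne⟩ := adj_iff.1 hbc
    have hbW := hW _ ih
    refine ih.trans (SimpleGraph.Adj.reachable (adj_iff.2 ⟨⟨hω, _, hbW, Sym2.mem_mk_left _ _⟩,
      hU, hne⟩))

/-- The event `{K = W}` is determined by the edges meeting `W`. [folklore] -/
theorem rK_inter_meeting_eq_iff (U W : Finset V) (o : V) (ω : Set (Sym2 V)) :
    (openCluster (ω ∩ meeting W ∩ edgesIn U) o) = ↑W ↔ (openCluster (ω ∩ edgesIn U) o) = ↑W := by
  have hmono : (openCluster (ω ∩ meeting W ∩ edgesIn U) o) ⊆ (openCluster (ω ∩ edgesIn U) o) := rK_mono U o Set.inter_subset_left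
  constructor
  · intro h
    refine Set.Subset.antisymm ?_ (h ▸ hmono)
    intro v hv
    have hW : ∀ u, (openGraph ((ω ∩ meeting W) ∩ edgesIn U)).Reachable o u → u ∈ W :=
      fun u hu => by
        have : u ∈ (openCluster (ω ∩ meeting W ∩ edgesIn U) o) := hu
        rw [h] at this
        exact this
    have := reach_inter_meeting hW hv
    rw [← h]
    exact this
  · intro h
    refine Set.Subset.antisymm (hmono.trans h.le) ?_
    intro v hv
    have hW : ∀ u, (openGraph ((ω ∩ meeting W) ∩ edgesIn U)).Reachable o u → u ∈ W :=
      fun u hu => by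
        have : u ∈ (openCluster (ω ∩ edgesIn U) o) := hmono hu
        rw [h] at this
        exact this
    have hv' : v ∈ (openCluster (ω ∩ edgesIn U) o) := by rw [h]; exact hv
    exact reach_inter_meeting hW hv'

/-- The bystander's cluster in `G[U ∖ Z]` does not depend on the edges meeting `Z`. [folklore] -/
theorem rK_diff_meeting (U Z : Finset V) (o : V) (ω : Set (Sym2 V)) :
    (openCluster (ω \ meeting Z ∩ edgesIn (U \ Z)) o) = (openCluster (ω ∩ edgesIn (U \ Z)) o) := by
  simp only [diff_meeting_inter_edgesIn]

/-- The bystander events of `G[U ∖ Z]` do not depend on the edges meeting `Z`. [folklore] -/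
theorem mem_rE_diff_meeting (U Z : Finset V) (o : V) (𝓡 : Set (Set V)) (T : Set V)
    (ω : Set (Sym2 V)) : ω \ meeting Z ∈ {η | (∃ t ∈ T, t ∈ openCluster (η ∩ edgesIn (U \ Z)) o) ∨ openCluster (η ∩ edgesIn (U \ Z)) o ∈ 𝓡} ↔ ω ∈ {η | (∃ t ∈ T, t ∈ openCluster (η ∩ edgesIn (U \ Z)) o) ∨ openCluster (η ∩ edgesIn (U \ Z)) o ∈ 𝓡} := by
  simp only [Set.mem_setOf_eq, rK_diff_meeting]

variable [Fintype V]

/-- Fibering a sum over configurations by the value of the bystander's cluster. [folklore] -/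
theorem sum_fiber_rK (U : Finset V) (o : V) (f : Set (Sym2 V) → ℝ) :
    ∑ ω, f ω = ∑ W : Finset V, ∑ ω, ind {ω | (openCluster (ω ∩ edgesIn U) o) = ↑W} ω * f ω := by
  rw [Finset.sum_comm]
  refine Finset.sum_congr rfl fun ω _ => ?_
  set W₀ : Finset V := Finset.univ.filter fun v => v ∈ (openCluster (ω ∩ edgesIn U) o) with hW₀
  have hW₀c : (↑W₀ : Set V) = (openCluster (ω ∩ edgesIn U) o) := by
    ext v; simp [hW₀]
  rw [Finset.sum_eq_single W₀]
  · rw [ind_of_mem (show ω ∈ {ω | (openCluster (ω ∩ edgesIn U) o) = ↑W₀} from hW₀c.symm), one_mul]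
  · intro W _ hW
    have : ω ∉ {ω | (openCluster (ω ∩ edgesIn U) o) = ↑W} := fun h => hW (Finset.coe_injective (by
      rw [hW₀c]; exact h.symm))
    rw [ind_of_not_mem this, zero_mul]
  · intro h; exact absurd (Finset.mem_univ W₀) h

omit [Fintype V] in
/-- `0 ≤ 1_{K = W}`. [folklore] -/
theorem ind_rK_nonneg (U : Finset V) (o : V) (W : Finset V) (ω : Set (Sym2 V)) :
    0 ≤ ind {ω | (openCluster (ω ∩ edgesIn U) o) = ↑W} ω := ind_nonneg _ _

/-- `0 ≤ P(K = W)`. [folklore] -/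
theorem massK_nonneg {w : Sym2 V → ℝ} (hw0 : ∀ e, 0 ≤ w e) (hw1 : ∀ e, w e ≤ 1)
    (U : Finset V) (o : V) (W : Finset V) : 0 ≤ (∑ η, weight w η * ind {η | openCluster (η ∩ edgesIn U) o = ↑W} η) :=
  Finset.sum_nonneg fun ω _ => mul_nonneg (weight_nonneg hw0 hw1 ω) (ind_nonneg _ _)

/-- **Markov property of the bystander's cluster** (block Fubini over the edges meeting `W`):
for `Ψ` not depending on the edges meeting `W`,
`E[1_{K = W} Ψ] = P(K = W) · E[Ψ]`. [folklore] -/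
theorem sum_ind_rK_mul (w : Sym2 V → ℝ) (hm : ∑ ω, weight w ω = 1) (U W : Finset V) (o : V)
    (Ψ : Set (Sym2 V) → ℝ) (hΨ : ∀ ω, Ψ (ω \ meeting W) = Ψ ω) :
    ∑ ω, weight w ω * (ind {ω | (openCluster (ω ∩ edgesIn U) o) = ↑W} ω * Ψ ω) =
      (∑ η, weight w η * ind {η | openCluster (η ∩ edgesIn U) o = ↑W} η) * ∑ ω, weight w ω * Ψ ω := by
  set Φ : Set (Sym2 V) → Set (Sym2 V) → ℝ := fun ζ η =>
    ind {ω | (openCluster (ω ∩ edgesIn U) o) = ↑W} ζ * Ψ η with hΦ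
  have hind : ∀ ω, ind {ω | (openCluster (ω ∩ edgesIn U) o) = ↑W} (ω ∩ meeting W) = ind {ω | (openCluster (ω ∩ edgesIn U) o) = ↑W} ω := by
    intro ω
    by_cases h : (openCluster (ω ∩ edgesIn U) o) = ↑W
    · rw [ind_of_mem (show ω ∈ {ω | (openCluster (ω ∩ edgesIn U) o) = ↑W} from h),
        ind_of_mem (show ω ∩ meeting W ∈ {ω | (openCluster (ω ∩ edgesIn U) o) = ↑W} from
          (rK_inter_meeting_eq_iff U W o ω).2 h)]
    · rw [ind_of_not_mem (show ω ∉ {ω | (openCluster (ω ∩ edgesIn U) o) = ↑W} from h),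
        ind_of_not_mem (show ω ∩ meeting W ∉ {ω | (openCluster (ω ∩ edgesIn U) o) = ↑W} from
          fun h' => h ((rK_inter_meeting_eq_iff U W o ω).1 h'))]
  have h1 : ∀ ω, ind {ω | (openCluster (ω ∩ edgesIn U) o) = ↑W} ω * Ψ ω = Φ (ω ∩ meeting W) (ω \ meeting W) := by
    intro ω
    show _ = ind {ω | (openCluster (ω ∩ edgesIn U) o) = ↑W} (ω ∩ meeting W) * Ψ (ω \ meeting W)
    rw [hind, hΨ]
  calc ∑ ω, weight w ω * (ind {ω | (openCluster (ω ∩ edgesIn U) o) = ↑W} ω * Ψ ω)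
      = (∑ ω, weight w ω) * ∑ ω, weight w ω * Φ (ω ∩ meeting W) (ω \ meeting W) := by
        rw [hm, one_mul]; simp_rw [h1]
    _ = ∑ ω, weight w ω * ∑ ω', weight w ω' * Φ (ω ∩ meeting W) (ω' \ meeting W) :=
        blockFubini w (meeting W) Φ
    _ = ∑ ω, weight w ω * (ind {ω | (openCluster (ω ∩ edgesIn U) o) = ↑W} ω * ∑ ω', weight w ω' * Ψ ω') := by
        refine Finset.sum_congr rfl fun ω _ => ?_
        congr 1
        rw [Finset.mul_sum]
        refine Finset.sum_congr rfl fun ω' _ => ?_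
        show weight w ω' * (ind {ω | (openCluster (ω ∩ edgesIn U) o) = ↑W} (ω ∩ meeting W) * Ψ (ω' \ meeting W)) = _
        rw [hind, hΨ]; ring
    _ = (∑ η, weight w η * ind {η | openCluster (η ∩ edgesIn U) o = ↑W} η) * ∑ ω, weight w ω * Ψ ω := by
        rw [Finset.sum_mul]
        exact Finset.sum_congr rfl fun ω _ => by ring


omit [Fintype V] in
/-- Indicators of equivalent memberships agree. [folklore] -/
theorem ind_congr {α β : Type*} {D : Set α} {D' : Set β} {a : α} {b : β} (h : a ∈ D ↔ b ∈ D') :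
    ind D a = ind D' b := by
  by_cases ha : a ∈ D
  · rw [ind_of_mem ha, ind_of_mem (h.1 ha)]
  · rw [ind_of_not_mem ha, ind_of_not_mem (fun hb => ha (h.2 hb))]

omit [Fintype V] in
/-- Deleting vertices shrinks the cluster of `s`. [folklore] -/
theorem rC_mono_set {U U' : Finset V} (hU : U' ⊆ U) (s : V) (ω : Set (Sym2 V)) :
    rC U' s ω ⊆ rC U s ω :=
  openEdgeCluster_mono (Set.inter_subset_inter_right _ (edgesIn_mono hU)) s

omit [Fintype V] in
/-- Deleting the vertex set `W` makes disconnection from `T` (off `W`) more likely, pointwise: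
`{s ↮ T in G[U]} ⊆ {s ↮ T ∖ W in G[U ∖ W]}`. [folklore] -/
theorem rD_subset_rD_sdiff (U W : Finset V) (s : V) (T : Set V) :
    rD U s T ⊆ rD (U \ W) s (T \ ↑W) := fun _ hω x hx hreach =>
  hω x hx.1 (hreach.mono (openGraph_le
    (Set.inter_subset_inter_right _ (edgesIn_mono Finset.sdiff_subset))))

/-! ### Conditioning on the attachment set of `Z = X ∩ Y` (BHK's (6) with a bystander) -/

omit [Fintype V] in
/-- **BHK's identity (6) for the bystander event**: for `Z ⊆ W`, `o ∉ Z`, the event `E_W` of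
`G[U]` is the event `E'_{(W ∖ Z) ∪ S(ω)}` of `G[U ∖ Z]`, with the same collection `𝓡`. [folklore] -/
theorem mem_rE_iff_restrict {U Z : Finset V} (hZU : Z ⊆ U) {o : V} (ho : o ∉ Z)
    (𝓡 : Set (Set V)) {W : Set V} (hZW : (↑Z : Set V) ⊆ W) (ω : Set (Sym2 V)) :
    ω ∈ {η | (∃ t ∈ W, t ∈ openCluster (η ∩ edgesIn U) o) ∨ openCluster (η ∩ edgesIn U) o ∈ 𝓡} ↔ ω ∈ {η | (∃ t ∈ (W \ ↑Z) ∪ rS U Z ω, t ∈ openCluster (η ∩ edgesIn (U \ Z)) o) ∨ openCluster (η ∩ edgesIn (U \ Z)) o ∈ 𝓡} := by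
  -- a vertex of `S` in the bystander's restricted cluster joins `o` to `Z ⊆ W` in `G[U]`
  have hviaS : ∀ n ∈ rS U Z ω, n ∈ (openCluster (ω ∩ edgesIn (U \ Z)) o) → ∃ t ∈ W, t ∈ (openCluster (ω ∩ edgesIn U) o) := by
    rintro n ⟨hnUZ, z, hzZ, hnz⟩ hn
    obtain ⟨hnU, hnZ⟩ := Finset.mem_sdiff.1 hnUZ
    refine ⟨z, hZW hzZ, (rK_mono_set Finset.sdiff_subset o ω hn).trans
      (SimpleGraph.Adj.reachable (adj_iff.2 ⟨hnz, ⟨hnU, hZU hzZ⟩, ?_⟩))⟩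
    rintro rfl
    exact hnZ hzZ
  -- otherwise the two clusters agree
  have hagree : (∀ n ∈ rS U Z ω, n ∉ (openCluster (ω ∩ edgesIn (U \ Z)) o)) → (openCluster (ω ∩ edgesIn U) o) = (openCluster (ω ∩ edgesIn (U \ Z)) o) := by
    intro hS
    refine Set.Subset.antisymm (fun v hv => (reach_restrict ho hS hv).2)
      (rK_mono_set Finset.sdiff_subset o ω)
  constructor
  · intro h
    by_cases hS : ∃ n ∈ rS U Z ω, n ∈ (openCluster (ω ∩ edgesIn (U \ Z)) o)
    · obtain ⟨n, hn, hnK⟩ := hS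
      exact Or.inl ⟨n, Or.inr hn, hnK⟩
    · push Not at hS
      rcases h with ⟨t, htW, htK⟩ | hR
      · have ht := reach_restrict ho hS htK
        exact Or.inl ⟨t, Or.inl ⟨htW, ht.1⟩, ht.2⟩
      · rw [hagree hS] at hR
        exact Or.inr hR
  · intro h
    by_cases hS : ∃ n ∈ rS U Z ω, n ∈ (openCluster (ω ∩ edgesIn (U \ Z)) o)
    · obtain ⟨n, hn, hnK⟩ := hS
      exact Or.inl (hviaS n hn hnK)
    · push Not at hS
      rcases h with ⟨t, ⟨htW, -⟩ | htS, htK⟩ | hR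
      · exact Or.inl ⟨t, htW, rK_mono_set Finset.sdiff_subset o ω htK⟩
      · exact absurd htK (hS t htS)
      · rw [← hagree hS] at hR
        exact Or.inr hR

/-- Block expectations of nonnegative functions are nonnegative. [folklore] -/
theorem blockE'_nonneg {w : Sym2 V → ℝ} (hw0 : ∀ e, 0 ≤ w e) (hw1 : ∀ e, w e ≤ 1)
    (U' : Finset V) (s o : V) (𝓡 : Set (Set V)) {H : Set (Sym2 V) → ℝ} (hH : ∀ a, 0 ≤ H a)
    (B T : Set V) : 0 ≤ (∑ η, weight w η * (H (rC U' s η) * (ind {η' | (∃ t ∈ B ∪ T, t ∈ openCluster (η' ∩ edgesIn U') o) ∨ openCluster (η' ∩ edgesIn U') o ∈ 𝓡} η * ind (rD U' s (B ∪ T)) η))) :=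
  Finset.sum_nonneg fun ω _ => mul_nonneg (weight_nonneg hw0 hw1 ω)
    (mul_nonneg (hH _) (mul_nonneg (ind_nonneg _ _) (ind_nonneg _ _)))

/-- **BHK's (6) with a bystander, summed**: conditioning on the attachment set `S` of `Z`.
[folklore] -/
theorem step_sum' {U Z : Finset V} (hZU : Z ⊆ U) {s o : V} (hs : s ∉ Z) (ho : o ∉ Z)
    {W : Set V} (hZW : (↑Z : Set V) ⊆ W) (w : Sym2 V → ℝ) (hm : ∑ ω, weight w ω = 1)
    (𝓡 : Set (Set V)) (H : Set (Sym2 V) → ℝ) :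
    ∑ ω, weight w ω * (H (rC U s ω) * (ind ({η | (∃ t ∈ W, t ∈ openCluster (η ∩ edgesIn U) o) ∨ openCluster (η ∩ edgesIn U) o ∈ 𝓡}) ω * ind (rD U s W) ω)) =
      ∑ ω, weight w ω * (∑ η, weight w η * (H (rC (U \ Z) s η) * (ind {η' | (∃ t ∈ W \ ↑Z ∪ rS U Z ω, t ∈ openCluster (η' ∩ edgesIn (U \ Z)) o) ∨ openCluster (η' ∩ edgesIn (U \ Z)) o ∈ 𝓡} η * ind (rD (U \ Z) s (W \ ↑Z ∪ rS U Z ω)) η))) := by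
  set A := meeting Z with hA
  set Φ : Set (Sym2 V) → Set (Sym2 V) → ℝ := fun ζ η =>
    H (rC (U \ Z) s η) * (ind ({η | (∃ t ∈ (W \ ↑Z) ∪ rS U Z ζ, t ∈ openCluster (η ∩ edgesIn (U \ Z)) o) ∨ openCluster (η ∩ edgesIn (U \ Z)) o ∈ 𝓡}) η *
      ind (rD (U \ Z) s ((W \ ↑Z) ∪ rS U Z ζ)) η) with hΦ
  have h1 : ∀ ω, H (rC U s ω) * (ind ({η | (∃ t ∈ W, t ∈ openCluster (η ∩ edgesIn U) o) ∨ openCluster (η ∩ edgesIn U) o ∈ 𝓡}) ω * ind (rD U s W) ω) =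
      Φ (ω ∩ A) (ω \ A) := by
    intro ω
    simp only [hΦ, hA, rS_inter_meeting, rC_diff_meeting]
    by_cases hω : ω ∈ rD U s W
    · have hω' := (mem_rD_iff_restrict hZU hs hZW ω).1 hω
      rw [ind_of_mem hω, ind_of_mem ((mem_rD_diff_meeting U Z s _ ω).2 hω'),
        rC_restrict hs fun n hn => hω' n (Or.inr hn),
        ind_congr ((mem_rE_iff_restrict hZU ho 𝓡 hZW ω).trans
          (mem_rE_diff_meeting U Z o 𝓡 _ ω).symm)]
    · have hω' : ω \ meeting Z ∉ rD (U \ Z) s ((W \ ↑Z) ∪ rS U Z ω) := fun h =>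
        hω ((mem_rD_iff_restrict hZU hs hZW ω).2 ((mem_rD_diff_meeting U Z s _ ω).1 h))
      rw [ind_of_not_mem hω, ind_of_not_mem hω', mul_zero, mul_zero, mul_zero, mul_zero]
  have h2 : ∀ ω ω', Φ (ω ∩ A) (ω' \ A) =
      H (rC (U \ Z) s ω') * (ind ({η | (∃ t ∈ (W \ ↑Z) ∪ rS U Z ω, t ∈ openCluster (η ∩ edgesIn (U \ Z)) o) ∨ openCluster (η ∩ edgesIn (U \ Z)) o ∈ 𝓡}) ω' *
        ind (rD (U \ Z) s ((W \ ↑Z) ∪ rS U Z ω)) ω') := by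
    intro ω ω'
    simp only [hΦ, hA, rS_inter_meeting, rC_diff_meeting]
    rw [ind_congr (mem_rE_diff_meeting U Z o 𝓡 _ ω'),
      ind_congr (mem_rD_diff_meeting U Z s _ ω')]
  calc ∑ ω, weight w ω * (H (rC U s ω) * (ind ({η | (∃ t ∈ W, t ∈ openCluster (η ∩ edgesIn U) o) ∨ openCluster (η ∩ edgesIn U) o ∈ 𝓡}) ω * ind (rD U s W) ω))
      = (∑ ω, weight w ω) * ∑ ω, weight w ω * Φ (ω ∩ A) (ω \ A) := by
        rw [hm, one_mul]; simp_rw [h1]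
    _ = ∑ ω, weight w ω * ∑ ω', weight w ω' * Φ (ω ∩ A) (ω' \ A) := blockFubini w A Φ
    _ = ∑ ω, weight w ω * (∑ η, weight w η * (H (rC (U \ Z) s η) * (ind {η' | (∃ t ∈ W \ ↑Z ∪ rS U Z ω, t ∈ openCluster (η' ∩ edgesIn (U \ Z)) o) ∨ openCluster (η' ∩ edgesIn (U \ Z)) o ∈ 𝓡} η * ind (rD (U \ Z) s (W \ ↑Z ∪ rS U Z ω)) η))) := by
        simp_rw [h2]


/-- **The Markov property of the bystander's cluster** (`stub_bystanderMarkov_k42`):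
 `E[1_{K=W} Ψ] = P(K = W) · E[Ψ]` for `Ψ` not looking at the pairs meeting `W` — the closed form of
`sum_ind_rK_mul` (vertex type in `Type`). [folklore] -/
theorem stub_bystanderMarkov_k42 : ∀ (V : Type) [Fintype V] (w : Sym2 V → ℝ), (∑ ω, weight w ω = 1) → ∀ (U W : Finset V) (o : V) (Ψ : Set (Sym2 V) → ℝ), (∀ ω, Ψ (ω \ meeting W) = Ψ ω) → ∑ ω, weight w ω * (ind {ω | openCluster (ω ∩ edgesIn U) o = ↑W} ω * Ψ ω) = (∑ η, weight w η * ind {η | openCluster (η ∩ edgesIn U) o = ↑W} η) * ∑ ω, weight w ω * Ψ ω :=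
  fun _ _ w hm U W o Ψ hΨ => sum_ind_rK_mul w hm U W o Ψ hΨ

end BystanderBHK

end Summit.CriticalPhenomena.PercolationContinuityZ3.Theorems
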